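import Mathlib
import HarnessLib
import Literature.AlgebraicGeometry.Ramification.InertiaStalkNormalSylow
import Literature.AlgebraicGeometry.Resolution.BlowupStalkCharts
import Literature.AlgebraicGeometry.Resolution.BlowupStalkEmbedding
import Literature.AlgebraicGeometry.Resolution.HilbertSamuelIsolatedSingularities
import Literature.AlgebraicGeometry.Resolution.AffineBlowupCartier
import Summits.ResolutionOfSingularities.ResolutionOfSingularities.Theorems.WildQuotientsWildQuotientResolutionStubInertiaLe

/-!
# Local data of an equivariant blow-up of closed points (crux `WildQuotients.WildQuotientResolution`, line `Sketch`)

Stub `stub_pointBlowupStalkData` of the skeleton `Sketch` for crux stmt-ResolutionOfSingularities-15640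
(route `ResolutionOfSingularities/WildQuotients`, card `p-closure-sylow-separation`). Phase 0 of the
wild-quotient resolution blows up, on a regular `G`-surface `X′` (affine over `X₁` through the
`G`-invariant `q`, `G` acting faithfully), the finite closed `G`-stable set `Z` of bad closed points
along its REDUCED ideal sheaf `𝓘_Z` (`Scheme.IdealSheafData.vanishingIdeal`); the action lifts to the
blow-up `π : X♯ → X′` (`π` equivariant). This file extracts, at a point `x ∈ X♯` over `z = π x ∈ Z`,
the local-algebra package consumed by the algebra stub `BorelCore.stub_borelCore`: with
`R = 𝒪_{X′,z}`, `S = 𝒪_{X♯,x}`, `ι = π^♯_x : R → S` and `I = I_x` the inertia group of `x`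
(Abbes–Saito 2011, 2.4; the tree's `Literature.AlgebraicGeometry.Ramification.inertiaSubgroup`),

* `I` acts on `R` (it fixes `z`, since `I_x ≤ I_z`, `InertiaLe.stub_inertia_le`) and on `S` by ring
  automorphisms `τ`, `τ₁` — for `g ∈ I` the stalk endomorphism `a_g = stalkSpecializes ≫ stalkMap`
  is characterised by `Spec(a_g) ≫ ι = ι ≫ g` with `ι : Spec 𝒪 → X` the canonical MONOMORPHISM, so
  multiplicativity and invertibility follow by cancelling `ι` (`exists_stalkAction`, the
  construction of `Ramification.hasNormalSylow_inertiaSubgroup_of_stalk`);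
* `τ` is injective (`Ramification.eq_one_of_fromSpecStalk_comp_eq`: a faithful action on an integral
  scheme over the separated `q` is faithful on every local scheme);
* `ι ∘ τ_g = τ₁_g ∘ ι` (the stalk form of `ρ♯ g ≫ π = π ≫ ρ g`, again by cancelling `ι`);
* `τ₁` is residue-trivial (the definition of `I_x`);
* `𝔪_R S = (ι t)` for some `t ∈ 𝔪_R`: the stalk of `𝓘_Z` at the isolated reduced point `z` is `𝔪_R`
  (`stalkIdeal_vanishingIdeal_of_finite`), `S` is a localisation of a chart `R[𝔪_R/c_j]` of the
  blowing up of `Spec R` along `𝔪_R = (c_1, …, c_k)` (`IsBlowup.exists_reesChart_stalk`), on which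
  `𝔪_R` generates the principal ideal `(c_j)` (`span_image_reesChartBase_eq`, Stacks 0804), so
  `t = c_j`;
* `ι` is injective (`IsBlowup.stalkMap_injective`).
-/

-- single-problem summit: the doubled namespace component `ResolutionOfSingularities` is forced
set_option linter.dupNamespace false

namespace Summit.ResolutionOfSingularities.ResolutionOfSingularities.Theorems.WildQuotientResolution.PointBlowupStalkData

open CategoryTheory AlgebraicGeometry TopologicalSpace IsLocalRing
open Literature.AlgebraicGeometry.Resolution Literature.AlgebraicGeometry.Ramification

/-- **A subgroup fixing a point acts on its local ring.** For an action `σ` of `G` on a scheme `X`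
by automorphisms and a subgroup `I` whose elements fix the point `x`, there are stalk endomorphisms
`a_g = stalkSpecializes ≫ (σ g)^♯_x` of `𝒪_{X,x}` (`g ∈ I`) characterised by
`Spec(a_g) ≫ ι = ι ≫ σ g`, `ι : Spec 𝒪_{X,x} → X` the canonical monomorphism, and a group
homomorphism `τ : I → Aut(𝒪_{X,x})`, `τ_g = a_{g⁻¹}` (the variance corrected), as in
`Ramification.hasNormalSylow_inertiaSubgroup_of_stalk`. [folklore] -/
theorem exists_stalkAction {X : Scheme.{0}} {G : Type} [Group G] (σ : G →* Aut X) (x : X)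
    (I : Subgroup G) (hI : ∀ g ∈ I, (σ g).hom.base x = x) :
    ∃ (a : I → (X.presheaf.stalk x ⟶ X.presheaf.stalk x))
      (τ : I →* (X.presheaf.stalk x ≃+* X.presheaf.stalk x)),
      (∀ g : I, Spec.map (a g) ≫ X.fromSpecStalk x = X.fromSpecStalk x ≫ (σ (g : G)).hom) ∧
      (∀ (g : I) (r : X.presheaf.stalk x), τ g r = (a g⁻¹).hom r) := by
  classical
  set F := X.fromSpecStalk x with hF
  have hfix : ∀ g : I, (σ (g : G)).hom.base x = x := fun g => hI g g.2
  -- the stalk endomorphism of `g ∈ I`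
  let a : I → (X.presheaf.stalk x ⟶ X.presheaf.stalk x) := fun g =>
    X.presheaf.stalkSpecializes (specializes_of_eq (hfix g)) ≫ (σ (g : G)).hom.stalkMap x
  have hkey : ∀ g : I, Spec.map (a g) ≫ F = F ≫ (σ (g : G)).hom := by
    intro g
    simp only [a, hF]
    rw [Spec.map_comp, Category.assoc, Scheme.SpecMap_stalkSpecializes_fromSpecStalk,
      Scheme.SpecMap_stalkMap_fromSpecStalk]
  have hone : a 1 = 𝟙 _ := by
    apply Spec.map_injective
    rw [← cancel_mono F, hkey, Spec.map_id, Category.id_comp]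
    simp
  have hmul : ∀ g h : I, a (g * h) = a g ≫ a h := by
    intro g h
    apply Spec.map_injective
    rw [← cancel_mono F, hkey, Spec.map_comp, Category.assoc, hkey, ← Category.assoc, hkey,
      Category.assoc, Subgroup.coe_mul, map_mul, aut_mul_hom]
  have hinv₁ : ∀ g : I, a g ≫ a g⁻¹ = 𝟙 _ := fun g => by rw [← hmul, mul_inv_cancel, hone]
  have hinv₂ : ∀ g : I, a g⁻¹ ≫ a g = 𝟙 _ := fun g => by rw [← hmul, inv_mul_cancel, hone]
  -- as ring automorphisms: `E g := a g⁻¹` (to correct the variance)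
  let E : I → (X.presheaf.stalk x ≃+* X.presheaf.stalk x) := fun g =>
    RingEquiv.ofRingHom (a g⁻¹).hom (a g).hom
      (by rw [← CommRingCat.hom_comp, hinv₁, CommRingCat.hom_id])
      (by rw [← CommRingCat.hom_comp, hinv₂, CommRingCat.hom_id])
  have hE : ∀ (g : I) (y : X.presheaf.stalk x), E g y = (a g⁻¹).hom y := fun g y => rfl
  refine ⟨a,
    { toFun := E
      map_one' := by
        apply RingEquiv.ext; intro y
        rw [hE, inv_one, hone]; rfl
      map_mul' := fun g h => by
        apply RingEquiv.ext; intro y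
        rw [RingAut.mul_apply, hE, hE, hE, mul_inv_rev, hmul, CommRingCat.hom_comp,
          RingHom.comp_apply] }, hkey, fun g r => rfl⟩

/-- **The local data of an equivariant blow-up of finitely many closed points, at a point over the
centre** — exactly the hypotheses of `BorelCore.stub_borelCore`. Let `π : X♯ → X′` be a blowing up
(`IsBlowup`) of the integral locally Noetherian `X′` along the reduced ideal `𝓘_Z`
(`Scheme.IdealSheafData.vanishingIdeal`) of a finite closed set `Z` of closed points, `G` acting on
`X′` faithfully over the affine `q` and on `X♯` with `π` equivariant, `x ∈ X♯` over `z = π x ∈ Z`,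
`I = I_x ≤ G` its inertia group. Then with `R = 𝒪_{X′,z}`, `S = 𝒪_{X♯,x}`, `ι = π^♯_x`: `I` acts on
`R` and on `S` by ring automorphisms `τ`, `τ₁` with `τ` injective, `ι ∘ τ_g = τ₁_g ∘ ι`, `τ₁`
residue-trivial; `𝔪_R S = (ι t)` for some `t ∈ 𝔪_R`; and `ι` is injective.
[folklore; cf. StacksProject, Tag 0804; AbbesSaito2011, 2.4] -/
theorem stub_pointBlowupStalkData {X' X₁ : Scheme.{0}} (q : X' ⟶ X₁) [IsAffineHom q]
    {G : Type} [Group G] [Finite G] (ρ : G →* Aut X') (hfaith : Function.Injective ρ)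
    (hρ : ∀ g : G, (ρ g).hom ≫ q = q) [IsIntegral X'] [IsLocallyNoetherian X']
    {Z : Set X'} (hZc : IsClosed Z) (hZf : Z.Finite) (hZpt : ∀ z ∈ Z, IsClosed ({z} : Set X'))
    {Xs : Scheme.{0}} {π : Xs ⟶ X'}
    (hπ : IsBlowup π (Scheme.IdealSheafData.vanishingIdeal ⟨Z, hZc⟩)) [IsIntegral Xs]
    (ρs : G →* Aut Xs) (hequiv : ∀ g : G, (ρs g).hom ≫ π = π ≫ (ρ g).hom)
    (x : Xs) (hx : π.base x ∈ Z) :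
    ∃ (τ : inertiaSubgroup ρs x →*
          (X'.presheaf.stalk (π.base x) ≃+* X'.presheaf.stalk (π.base x)))
      (τ₁ : inertiaSubgroup ρs x →* (Xs.presheaf.stalk x ≃+* Xs.presheaf.stalk x))
      (t : X'.presheaf.stalk (π.base x)),
      Function.Injective τ ∧
      (∀ (g : inertiaSubgroup ρs x) (r : X'.presheaf.stalk (π.base x)),
        (π.stalkMap x).hom (τ g r) = τ₁ g ((π.stalkMap x).hom r)) ∧
      (∀ (g : inertiaSubgroup ρs x) (s : Xs.presheaf.stalk x),
        τ₁ g s - s ∈ maximalIdeal (Xs.presheaf.stalk x)) ∧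
      t ∈ maximalIdeal (X'.presheaf.stalk (π.base x)) ∧
      Ideal.map (π.stalkMap x).hom (maximalIdeal (X'.presheaf.stalk (π.base x))) =
        Ideal.span {(π.stalkMap x).hom t} ∧
      Function.Injective (π.stalkMap x).hom := by
  classical
  -- `I_x ≤ I_z`: every element of `I = I_x` fixes `x` and `z = π x`
  have hle : inertiaSubgroup ρs x ≤ inertiaSubgroup ρ (π.base x) :=
    InertiaLe.stub_inertia_le ρs ρ π hequiv x
  -- the actions on `S = 𝒪_{X♯,x}` and on `R = 𝒪_{X′,z}`
  obtain ⟨a, τ₁, hkeya, hτa⟩ := exists_stalkAction ρs x (inertiaSubgroup ρs x)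
    (fun g hg => apply_eq_of_mem_inertiaSubgroup ρs hg)
  obtain ⟨b, τ, hkeyb, hτb⟩ := exists_stalkAction ρ (π.base x) (inertiaSubgroup ρs x)
    (fun g hg => apply_eq_of_mem_inertiaSubgroup ρ (hle hg))
  -- the stalk of the centre at `z` is `𝔪_R`; generators, and a chart of the blow-up through `x`
  have hst : stalkIdeal (Scheme.IdealSheafData.vanishingIdeal ⟨Z, hZc⟩) (π.base x) =
      maximalIdeal (X'.presheaf.stalk (π.base x)) :=
    stalkIdeal_vanishingIdeal_of_finite (Z := ⟨Z, hZc⟩) hZf hZpt hx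
  obtain ⟨k, c, hc⟩ :=
    exists_fin_span_eq_stalkIdeal (Scheme.IdealSheafData.vanishingIdeal ⟨Z, hZc⟩) (π.base x)
  obtain ⟨j, 𝔴, χ, hχ, -, -⟩ := hπ.exists_reesChart_stalk x c hc
  -- compatibility of the two actions with `ι = π^♯_x`: cancel the monomorphism
  -- `Spec 𝒪_{X′,z} → X′`
  have hcompat : ∀ h : inertiaSubgroup ρs x, b h ≫ π.stalkMap x = π.stalkMap x ≫ a h := by
    intro h
    apply Spec.map_injective
    rw [← cancel_mono (X'.fromSpecStalk (π.base x))]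
    simp only [Spec.map_comp, Category.assoc, hkeyb, Scheme.SpecMap_stalkMap_fromSpecStalk,
      Scheme.SpecMap_stalkMap_fromSpecStalk_assoc]
    rw [reassoc_of% (hkeya h), hequiv]
  refine ⟨τ, τ₁, c j, ?_, ?_, ?_, ?_, ?_, hπ.stalkMap_injective x⟩
  · -- `τ` is injective: the action is faithful on the local scheme `Spec 𝒪_{X′,z} → X′`
    rw [injective_iff_map_eq_one]
    intro g hg
    have h1 : b g⁻¹ = 𝟙 _ := by
      ext y
      have := RingEquiv.congr_fun hg y
      rw [hτb] at this
      simpa using this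
    have h2 : X'.fromSpecStalk (π.base x) ≫ (ρ ((g⁻¹ : inertiaSubgroup ρs x) : G)).hom =
        X'.fromSpecStalk (π.base x) := by
      rw [← hkeyb, h1, Spec.map_id, Category.id_comp]
    have h3 : ((g⁻¹ : inertiaSubgroup ρs x) : G) = 1 :=
      eq_one_of_fromSpecStalk_comp_eq ρ q hρ hfaith (π.base x) _ h2
    have : (g⁻¹ : inertiaSubgroup ρs x) = 1 := Subtype.ext h3
    exact inv_eq_one.mp this
  · -- compatibility with `ι`
    intro g r
    rw [hτb, hτa, ← CommRingCat.comp_apply, ← CommRingCat.comp_apply, hcompat]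
  · -- `τ₁` is residue-trivial: `Spec κ(x) → X♯` is fixed by the elements of `I_x`
    intro g s
    rw [hτa]
    set k : inertiaSubgroup ρs x := g⁻¹
    have hk : Xs.fromSpecResidueField x ≫ (ρs (k : G)).hom = Xs.fromSpecResidueField x :=
      (mem_inertiaSubgroup_iff ρs).mp k.2
    have hk' : a k ≫ Xs.residue x = Xs.residue x := by
      apply Spec.map_injective
      rw [Spec.map_comp, ← cancel_mono (Xs.fromSpecStalk x), Category.assoc, hkeya,
        ← Category.assoc]
      exact hk
    have hval : (Xs.residue x).hom ((a k).hom s) = (Xs.residue x).hom s := by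
      rw [← CommRingCat.comp_apply, hk']
    rw [← residue_eq_zero_iff, map_sub, sub_eq_zero]
    exact hval
  · -- `t = c_j ∈ 𝔪_R`
    rw [← hst, ← hc]
    exact Ideal.subset_span (Set.mem_range_self j)
  · -- `𝔪_R S = (ι c_j)`: `S` is a localisation of the chart `R[𝔪_R/c_j]`, on which `𝔪_R`
    -- generates `(c_j)`
    have h1 : (Ideal.span (Set.range c)).map (chartBase c j) = Ideal.span {chartBase c j (c j)} :=
      span_image_reesChartBase_eq (c j) _
    have h2 : (π.stalkMap x).hom = χ.comp (chartBase c j) := (RingHom.ext hχ).symm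
    rw [← hst, ← hc, h2, RingHom.comp_apply, ← Ideal.map_map, h1, Ideal.map_span,
      Set.image_singleton]

end Summit.ResolutionOfSingularities.ResolutionOfSingularities.Theorems.WildQuotientResolution.PointBlowupStalkData
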